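import Summits.Parity.GeneralizedHardyLittlewood.Theorems.ChenParityOracleBLAPHostParityFromBrickSwitchedBoxes
import Summits.Parity.GeneralizedHardyLittlewood.Theorems.ChenParityOracleBLAPHostParityFromBrickSwitchedCount
import HarnessLib

/-!
# Route `ChenParityOracleBLAP` — crux S1 = `HostParityFromBrick` (stmt-Parity-20045): the bad classes of the switched host

Support file for the switched half `K1 → K2 → HP2` of S1.  The Chen triples `(p₁, p₂, p₃)` whose
`ρ`-adic class is NOT good — small products `p₁p₂p₃ < 8x^{1−δ}`, or `p₂, p₃` in the same `ρ`-adic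
interval, or `p₁p₂p₃ > (x+2)/ρ³` — contribute to the twisted level sum
`∑_{d ≤ D} |∑ [d ∣ p₁p₂p₃−2] λ(p₁p₂p₃−2)|` at most
`⌊8x^{1−δ}⌋(1 + log⌊8x^{1−δ}⌋) + √((ρ−1)(x+2)(1+log y) + y√(x+2) + 3(ρ−1)(x+2) + 1) · √((x+2)(1+log(x+2))³)`
(`sum_abs_bad_le`): the `ℓ¹`-over-`d` mass of a set of triples is `≤ ∑ τ(p₁p₂p₃ − 2)`
(`sum_abs_triples_le_sum_tau`), bounded on an initial segment by Dirichlet and on the sparse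
boundary by Cauchy–Schwarz (`…SwitchedCount`).

References: Chen Jing-run, Sci. Sinica 16 (1973) [ChenSciSinica1973]; M. B. Nathanson, *Additive
Number Theory: The Classical Bases* (1996), §10.2, (10.13) [Nathanson1996].
-/

namespace Summit.Parity.GeneralizedHardyLittlewood.Theorems

open Finset Real
open Literature.NumberTheory.Sieve.Chen

/-! ### Products versus `ρ`-adic indices -/

/-- `p₁p₂p₃ < ρ^{k+i+j+3}` for the indices `(k, i, j)` of `(p₁, p₂, p₃)`. -/
theorem prod3_lt_rho_pow {ρ : ℝ} (hρ : 1 < ρ) (t : ℕ × ℕ × ℕ) :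
    ((t.1 * t.2.1 * t.2.2 : ℕ) : ℝ) <
      ρ ^ (⌊Real.log t.1 / Real.log ρ⌋₊ + ⌊Real.log t.2.1 / Real.log ρ⌋₊ +
        ⌊Real.log t.2.2 / Real.log ρ⌋₊ + 3) := by
  have h1 := lt_rho_pow_floor_succ hρ t.1
  have h2 := lt_rho_pow_floor_succ hρ t.2.1
  have h3 := lt_rho_pow_floor_succ hρ t.2.2
  have hρ0 : (0 : ℝ) < ρ := by linarith
  push_cast
  calc (t.1 : ℝ) * t.2.1 * t.2.2
      < ρ ^ (⌊Real.log t.1 / Real.log ρ⌋₊ + 1) * ρ ^ (⌊Real.log t.2.1 / Real.log ρ⌋₊ + 1) *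
          ρ ^ (⌊Real.log t.2.2 / Real.log ρ⌋₊ + 1) :=
        mul_lt_mul'' (mul_lt_mul'' h1 h2 (Nat.cast_nonneg _) (Nat.cast_nonneg _)) h3
          (by positivity) (Nat.cast_nonneg _)
    _ = _ := by rw [← pow_add, ← pow_add]; ring_nf

/-- `ρ^{k+i+j} ≤ p₁p₂p₃` for the indices `(k, i, j)` of `(p₁, p₂, p₃)`, all `≥ 1`. -/
theorem rho_pow_le_prod3 {ρ : ℝ} (hρ : 1 < ρ) {t : ℕ × ℕ × ℕ} (h1 : 1 ≤ t.1) (h2 : 1 ≤ t.2.1)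
    (h3 : 1 ≤ t.2.2) :
    ρ ^ (⌊Real.log t.1 / Real.log ρ⌋₊ + ⌊Real.log t.2.1 / Real.log ρ⌋₊ +
        ⌊Real.log t.2.2 / Real.log ρ⌋₊) ≤ ((t.1 * t.2.1 * t.2.2 : ℕ) : ℝ) := by
  have e1 := rho_pow_floor_le hρ h1
  have e2 := rho_pow_floor_le hρ h2
  have e3 := rho_pow_floor_le hρ h3
  have hρ0 : (0 : ℝ) < ρ := by linarith
  push_cast
  rw [pow_add, pow_add]
  exact mul_le_mul (mul_le_mul e1 e2 (by positivity) (Nat.cast_nonneg _)) e3 (by positivity)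
    (by positivity)

/-! ### The `ℓ¹`-over-`d` mass of a set of triples -/

/-- For any finite set `S` of triples with `p₁p₂p₃ ≥ 3`:
`∑_{1 ≤ d ≤ D} |∑_{t ∈ S} [d ∣ p₁p₂p₃ − 2] λ(p₁p₂p₃ − 2)| ≤ ∑_{t ∈ S} τ(p₁p₂p₃ − 2)`. -/
theorem sum_abs_triples_le_sum_tau (S : Finset (ℕ × ℕ × ℕ)) (hS : ∀ t ∈ S, 3 ≤ t.1 * t.2.1 * t.2.2)
    (D : ℕ) :
    ∑ d ∈ Finset.Icc 1 D, |∑ t ∈ S, (if d ∣ t.1 * t.2.1 * t.2.2 - 2 then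
        (ArithmeticFunction.liouville (t.1 * t.2.1 * t.2.2 - 2) : ℝ) else 0)| ≤
      ∑ t ∈ S, (((t.1 * t.2.1 * t.2.2 - 2).divisors.card : ℕ) : ℝ) := by
  have h1 : ∀ d ∈ Finset.Icc 1 D, |∑ t ∈ S, (if d ∣ t.1 * t.2.1 * t.2.2 - 2 then
        (ArithmeticFunction.liouville (t.1 * t.2.1 * t.2.2 - 2) : ℝ) else 0)| ≤
      ∑ t ∈ S, (if d ∣ t.1 * t.2.1 * t.2.2 - 2 then (1 : ℝ) else 0) := by
    intro d _
    refine (Finset.abs_sum_le_sum_abs _ _).trans (Finset.sum_le_sum fun t _ => ?_)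
    split_ifs
    · have := Literature.NumberTheory.Sieve.abs_liouville_le_one (t.1 * t.2.1 * t.2.2 - 2)
      exact_mod_cast this
    · simp
  refine (Finset.sum_le_sum h1).trans ?_
  rw [Finset.sum_comm]
  refine Finset.sum_le_sum fun t ht => ?_
  have he : t.1 * t.2.1 * t.2.2 - 2 ≠ 0 := by have := hS t ht; omega
  rw [← Finset.sum_filter]
  simp only [Finset.sum_const, nsmul_eq_mul, mul_one]
  exact_mod_cast card_Icc_filter_dvd_le_card_divisors he D


/-! ### The bad classes: small products and the two boundaries -/

/-- **The bad classes of the switched host.**  For `ρ ∈ (1, 6/5]` and `x ≥ 24`, the triples of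
`B(x)` whose class `(k, i, j)` is NOT good (`¬(i < j ∧ 8x^{1−δ} < ρ^{k+i+j+3} ≤ x + 2)`) contribute
to the twisted level sum at most
`⌊8x^{1−δ}⌋ (1 + log⌊8x^{1−δ}⌋) + √((ρ−1)(x+2)(1+log y) + y√(x+2) + 3(ρ−1)(x+2) + 1) · √((x+2)(1+log(x+2))³)`
(small products trivially; `p₂, p₃` `ρ`-close or `p₁p₂p₃ > (x+2)/ρ³` by counting and Cauchy–Schwarz). -/
theorem sum_abs_bad_le {x : ℕ} (hx24 : 24 ≤ x) {ρ δ : ℝ} (hρ : 1 < ρ) (hρ2 : ρ ≤ 6 / 5) (D : ℕ) :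
    ∑ d ∈ Finset.Icc 1 D, |∑ t ∈ ((Finset.range (x + 3) ×ˢ Finset.range (x + 3) ×ˢ
        Finset.range (x + 3)).filter
        (fun t : ℕ × ℕ × ℕ => t.1.Prime ∧ t.2.1.Prime ∧ t.2.2.Prime ∧ twinZ x ≤ t.1 ∧ t.1 < twinY x ∧
          twinY x ≤ t.2.1 ∧ t.2.1 ≤ t.2.2 ∧ t.1 * t.2.1 * t.2.2 ≤ x + 2)).filter
        (fun t : ℕ × ℕ × ℕ => ¬ (⌊Real.log t.2.1 / Real.log ρ⌋₊ < ⌊Real.log t.2.2 / Real.log ρ⌋₊ ∧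
          ρ ^ (⌊Real.log t.1 / Real.log ρ⌋₊ + ⌊Real.log t.2.1 / Real.log ρ⌋₊ +
            ⌊Real.log t.2.2 / Real.log ρ⌋₊ + 3) ≤ (x : ℝ) + 2 ∧
          8 * (x : ℝ) ^ (1 - δ) < ρ ^ (⌊Real.log t.1 / Real.log ρ⌋₊ + ⌊Real.log t.2.1 / Real.log ρ⌋₊ +
            ⌊Real.log t.2.2 / Real.log ρ⌋₊ + 3))),
        (if d ∣ t.1 * t.2.1 * t.2.2 - 2 then
          (ArithmeticFunction.liouville (t.1 * t.2.1 * t.2.2 - 2) : ℝ) else 0)| ≤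
      (⌊8 * (x : ℝ) ^ (1 - δ)⌋₊ : ℝ) * (1 + Real.log (⌊8 * (x : ℝ) ^ (1 - δ)⌋₊ : ℕ)) +
        Real.sqrt ((ρ - 1) * ((x + 2 : ℕ) : ℝ) * (1 + Real.log (twinY x)) +
            twinY x * Real.sqrt ((x + 2 : ℕ) : ℝ) + (3 * (ρ - 1) * ((x + 2 : ℕ) : ℝ) + 1)) *
          Real.sqrt (((x + 2 : ℕ) : ℝ) * (1 + Real.log ((x + 2 : ℕ) : ℝ)) ^ 3) := by
  classical
  set T := ((Finset.range (x + 3) ×ˢ Finset.range (x + 3) ×ˢ Finset.range (x + 3)).filter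
        (fun t : ℕ × ℕ × ℕ => t.1.Prime ∧ t.2.1.Prime ∧ t.2.2.Prime ∧ twinZ x ≤ t.1 ∧ t.1 < twinY x ∧
          twinY x ≤ t.2.1 ∧ t.2.1 ≤ t.2.2 ∧ t.1 * t.2.1 * t.2.2 ≤ x + 2)) with hTdef
  set idx : ℕ → ℕ := fun p => ⌊Real.log p / Real.log ρ⌋₊ with hidx
  set good : ℕ × ℕ × ℕ → Prop := fun t => idx t.2.1 < idx t.2.2 ∧
    ρ ^ (idx t.1 + idx t.2.1 + idx t.2.2 + 3) ≤ (x : ℝ) + 2 ∧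
    8 * (x : ℝ) ^ (1 - δ) < ρ ^ (idx t.1 + idx t.2.1 + idx t.2.2 + 3) with hgood
  set small : ℕ × ℕ × ℕ → Prop := fun t =>
    ρ ^ (idx t.1 + idx t.2.1 + idx t.2.2 + 3) ≤ 8 * (x : ℝ) ^ (1 - δ) with hsmall
  set X : ℕ := x + 2 with hX
  set n₀ : ℕ := ⌊8 * (x : ℝ) ^ (1 - δ)⌋₊ with hn₀
  have hρ0 : (0 : ℝ) < ρ := by linarith
  have hρ1 : (0 : ℝ) ≤ ρ - 1 := by linarith
  have hx0 : (0 : ℝ) ≤ x := Nat.cast_nonneg _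
  -- structure of `T`
  have hT : ∀ t ∈ T, t.1.Prime ∧ t.2.1.Prime ∧ t.2.2.Prime ∧ twinZ x ≤ t.1 ∧ t.1 < twinY x ∧
      twinY x ≤ t.2.1 ∧ t.2.1 ≤ t.2.2 ∧ t.1 * t.2.1 * t.2.2 ≤ x + 2 := by
    intro t ht; rw [hTdef, Finset.mem_filter] at ht; exact ht.2
  have hsorted : ∀ t ∈ T, t.1.Prime ∧ t.2.1.Prime ∧ t.2.2.Prime ∧ t.1 ≤ t.2.1 ∧ t.2.1 ≤ t.2.2 := by
    intro t ht
    obtain ⟨h1, h2, h3, -, hy, hy', h23, -⟩ := hT t ht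
    exact ⟨h1, h2, h3, by omega, h23⟩
  have h8 : ∀ t ∈ T, 8 ≤ t.1 * t.2.1 * t.2.2 := by
    intro t ht
    obtain ⟨h1, h2, h3, -⟩ := hT t ht
    have := h1.two_le; have := h2.two_le; have := h3.two_le
    calc 8 = 2 * 2 * 2 := by norm_num
      _ ≤ t.1 * t.2.1 * t.2.2 := by gcongr
  set S := T.filter (fun t => ¬ good t) with hS
  have hST : S ⊆ T := Finset.filter_subset _ _
  -- step 1: `ℓ¹` mass ≤ `∑ τ`
  have h1 := sum_abs_triples_le_sum_tau S (fun t ht => by have := h8 t (hST ht); omega) D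
  refine h1.trans ?_
  -- step 2: split `S` into small and boundary
  rw [← Finset.sum_filter_add_sum_filter_not S small]
  have hinjT := prod3_sub_two_injOn T hsorted
  refine add_le_add ?_ ?_
  · -- small classes: `e = p₁p₂p₃ − 2 ≤ 8x^{1−δ}`
    have hinj : Set.InjOn (fun t : ℕ × ℕ × ℕ => t.1 * t.2.1 * t.2.2 - 2) (S.filter small : Finset _) :=
      hinjT.mono (by intro t ht; exact hST (Finset.mem_filter.mp ht).1)
    rw [← Finset.sum_image (f := fun e : ℕ => ((e.divisors.card : ℕ) : ℝ)) hinj]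
    refine sum_card_divisors_le_of_subset_Icc fun e he => ?_
    rw [Finset.mem_image] at he
    obtain ⟨t, ht, rfl⟩ := he
    rw [Finset.mem_filter] at ht
    obtain ⟨htS, hsm⟩ := ht
    have htT := hST htS
    have hv8 := h8 t htT
    have hvlt : ((t.1 * t.2.1 * t.2.2 : ℕ) : ℝ) < 8 * (x : ℝ) ^ (1 - δ) :=
      (prod3_lt_rho_pow hρ t).trans_le hsm
    have hvle : t.1 * t.2.1 * t.2.2 ≤ n₀ := Nat.le_floor hvlt.le
    rw [Finset.mem_Icc]; omega
  · -- boundary classes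
    set S' := S.filter (fun t => ¬ small t) with hS'
    have hS'T : S' ⊆ T := (Finset.filter_subset _ _).trans hST
    have hinj : Set.InjOn (fun t : ℕ × ℕ × ℕ => t.1 * t.2.1 * t.2.2 - 2) (S' : Finset _) :=
      hinjT.mono (by intro t ht; exact hS'T ht)
    rw [← Finset.sum_image (f := fun e : ℕ => ((e.divisors.card : ℕ) : ℝ)) hinj]
    have himg : S'.image (fun t : ℕ × ℕ × ℕ => t.1 * t.2.1 * t.2.2 - 2) ⊆ Finset.Icc 1 X := by
      intro e he
      rw [Finset.mem_image] at he
      obtain ⟨t, ht, rfl⟩ := he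
      have := h8 t (hS'T ht); have := (hT t (hS'T ht)).2.2.2.2.2.2.2
      rw [Finset.mem_Icc]; omega
    refine (sum_card_divisors_le_sqrt himg).trans ?_
    rw [Finset.card_image_of_injOn hinj]
    refine mul_le_mul_of_nonneg_right (Real.sqrt_le_sqrt ?_) (Real.sqrt_nonneg _)
    -- `#S' ≤ #close + #top`
    set Sc := T.filter (fun t => (t.2.2 : ℝ) < ρ * t.2.1) with hSc
    set St := T.filter (fun t => ((X : ℕ) : ℝ) / ρ ^ 3 < ((t.1 * t.2.1 * t.2.2 : ℕ) : ℝ)) with hSt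
    have hsub : S' ⊆ Sc ∪ St := by
      intro t ht
      rw [hS', Finset.mem_filter, hS, Finset.mem_filter] at ht
      obtain ⟨⟨htT, hng⟩, hns⟩ := ht
      obtain ⟨h1, h2, h3, -, -, -, h23, -⟩ := hT t htT
      rw [Finset.mem_union]
      simp only [hgood, not_and_or, not_lt, not_le] at hng hns
      have hns' : 8 * (x : ℝ) ^ (1 - δ) < ρ ^ (idx t.1 + idx t.2.1 + idx t.2.2 + 3) := by
        simpa [hsmall] using hns
      rcases hng with hij | htop | hbot
      · -- `i = j`: `p₃ < ρ^{j+1} = ρ ρ^i ≤ ρ p₂`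
        left
        refine Finset.mem_filter.mpr ⟨htT, ?_⟩
        have hle : idx t.2.1 ≤ idx t.2.2 := floor_log_div_mono hρ h23
        have heq : idx t.2.1 = idx t.2.2 := le_antisymm hle hij
        have hp3 := lt_rho_pow_floor_succ hρ t.2.2
        have hp2 := rho_pow_floor_le hρ h2.one_lt.le
        change (t.2.2 : ℝ) < ρ ^ (idx t.2.2 + 1) at hp3
        change ρ ^ (idx t.2.1) ≤ (t.2.1 : ℝ) at hp2
        rw [← heq, pow_succ] at hp3
        calc (t.2.2 : ℝ) < ρ ^ idx t.2.1 * ρ := hp3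
          _ ≤ t.2.1 * ρ := by gcongr
          _ = ρ * t.2.1 := mul_comm _ _
      · right
        refine Finset.mem_filter.mpr ⟨htT, ?_⟩
        have hge := rho_pow_le_prod3 hρ (t := t) h1.one_lt.le h2.one_lt.le h3.one_lt.le
        rw [div_lt_iff₀ (by positivity)]
        calc ((X : ℕ) : ℝ) = (x : ℝ) + 2 := by rw [hX]; push_cast; ring
          _ < ρ ^ (idx t.1 + idx t.2.1 + idx t.2.2 + 3) := htop
          _ = ρ ^ (idx t.1 + idx t.2.1 + idx t.2.2) * ρ ^ 3 := pow_add _ _ _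
          _ ≤ _ := by gcongr
      · exact absurd hbot (not_le.mpr hns')
    have hcard : (#S' : ℝ) ≤ #Sc + #St := by
      exact_mod_cast (Finset.card_le_card hsub).trans (Finset.card_union_le _ _)
    -- the two counts
    have hclose : (#Sc : ℝ) ≤ (ρ - 1) * ((X : ℕ) : ℝ) * (1 + Real.log (twinY x)) +
        twinY x * Real.sqrt ((X : ℕ) : ℝ) := by
      refine card_close_triples_le hρ.le fun t ht => ?_
      rw [hSc, Finset.mem_filter] at ht
      obtain ⟨htT, hlt⟩ := ht
      obtain ⟨h1, h2, -, -, hy, -, h23, hprod⟩ := hT t htT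
      refine ⟨h1.one_lt.le, hy, h2.one_lt.le, h23, hlt, ?_⟩
      calc t.1 * t.2.1 * t.2.1 ≤ t.1 * t.2.1 * t.2.2 := by gcongr
        _ ≤ X := hprod
    have htop : (#St : ℝ) ≤ 3 * (ρ - 1) * ((X : ℕ) : ℝ) + 1 := by
      set L : ℕ := ⌊((X : ℕ) : ℝ) / ρ ^ 3⌋₊ with hL
      have hinjt : Set.InjOn (fun t : ℕ × ℕ × ℕ => t.1 * t.2.1 * t.2.2) (St : Finset _) :=
        (prod3_injOn_sorted T hsorted).mono (by intro t ht; exact Finset.filter_subset _ _ ht)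
      have hc := card_top_triples_le (L := L) (X := X) hinjt fun t ht => by
        rw [hSt, Finset.mem_filter] at ht
        obtain ⟨htT, hlt⟩ := ht
        refine ⟨?_, (hT t htT).2.2.2.2.2.2.2⟩
        have hL' : (L : ℝ) ≤ ((X : ℕ) : ℝ) / ρ ^ 3 := Nat.floor_le (by positivity)
        exact_mod_cast hL'.trans_lt hlt
      have hLge : ((X : ℕ) : ℝ) / ρ ^ 3 - 1 ≤ L := by
        have := Nat.lt_floor_add_one (((X : ℕ) : ℝ) / ρ ^ 3); rw [← hL] at this; linarith
      have hX0 : (0 : ℝ) ≤ ((X : ℕ) : ℝ) := Nat.cast_nonneg _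
      have hfrac : ((X : ℕ) : ℝ) - ((X : ℕ) : ℝ) / ρ ^ 3 ≤ 3 * (ρ - 1) * ((X : ℕ) : ℝ) := by
        -- `1 - ρ⁻³ = (ρ³ - 1)/ρ³ ≤ 3(ρ - 1)` since `ρ² + ρ + 1 ≤ 3ρ³`
        have hf : ρ ^ 2 + ρ + 1 ≤ 3 * ρ ^ 3 := by
          have : 0 ≤ (ρ - 1) * (3 * ρ ^ 2 + 2 * ρ + 1) := mul_nonneg hρ1 (by positivity)
          nlinarith
        have hkey : ρ ^ 3 - 1 ≤ 3 * (ρ - 1) * ρ ^ 3 := by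
          have e : ρ ^ 3 - 1 = (ρ - 1) * (ρ ^ 2 + ρ + 1) := by ring
          rw [e]
          calc (ρ - 1) * (ρ ^ 2 + ρ + 1) ≤ (ρ - 1) * (3 * ρ ^ 3) := mul_le_mul_of_nonneg_left hf hρ1
            _ = 3 * (ρ - 1) * ρ ^ 3 := by ring
        have hk : 1 - 1 / ρ ^ 3 ≤ 3 * (ρ - 1) := by
          rw [show (1 : ℝ) - 1 / ρ ^ 3 = (ρ ^ 3 - 1) / ρ ^ 3 by field_simp,
            div_le_iff₀ (by positivity)]
          exact hkey
        calc ((X : ℕ) : ℝ) - ((X : ℕ) : ℝ) / ρ ^ 3 = ((X : ℕ) : ℝ) * (1 - 1 / ρ ^ 3) := by ring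
          _ ≤ ((X : ℕ) : ℝ) * (3 * (ρ - 1)) := mul_le_mul_of_nonneg_left hk hX0
          _ = 3 * (ρ - 1) * ((X : ℕ) : ℝ) := by ring
      have hsub' : ((X - L : ℕ) : ℝ) ≤ ((X : ℕ) : ℝ) - L := by
        rcases le_or_gt L X with h | h
        · rw [Nat.cast_sub h]
        · rw [Nat.sub_eq_zero_of_le h.le, Nat.cast_zero]
          have : (L : ℝ) ≤ ((X : ℕ) : ℝ) / ρ ^ 3 := Nat.floor_le (by positivity)
          have h3 : ((X : ℕ) : ℝ) / ρ ^ 3 ≤ ((X : ℕ) : ℝ) :=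
            div_le_self hX0 (one_le_pow₀ hρ.le)
          linarith
      calc (#St : ℝ) ≤ ((X - L : ℕ) : ℝ) := by exact_mod_cast hc
        _ ≤ ((X : ℕ) : ℝ) - L := hsub'
        _ ≤ 3 * (ρ - 1) * ((X : ℕ) : ℝ) + 1 := by linarith
    linarith


end Summit.Parity.GeneralizedHardyLittlewood.Theorems
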